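import Mathlib
import Summits.ValiantsHypothesis.ValiantsHypothesis.Theorems.NewtonUnitEquationsDissociatedUniformStubExposedGenericDirection
import Summits.ValiantsHypothesis.ValiantsHypothesis.Theorems.NewtonUnitEquationsNewtonTauWeakRefineDissociate
import Summits.ValiantsHypothesis.ValiantsHypothesis.Theorems.NewtonUnitEquationsNewtonTauWeakStubChartPairCount

/-!
# `NewtonUnitEquationsNewtonTauWeakMinkowskiVertexBoundOfChart` — hull vertices of a planar Minkowski sum, from the chart lemma

Registered stub `stub_minkowskiVertexBoundOfChart` (RungC7 Q1b) of line `binomial-normal-form` (crux `NewtonTauWeak`,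
stmt-ValiantsHypothesis-5904, lead c7, namespace `RungC7` of `Cruxes/NewtonTauWeak/Lines/binomial_normal_form.lean`,
wave 1: THEOREM W♯, Gusfield halving).

Setting.  Finite `P Q ⊆ ℕ²`, embedded in `ℝ²` by `emb e i = (e i : ℝ)`; the Minkowski sum
`P ⊕ Q := (P ×ˢ Q).image (·.1 + ·.2)`; `#vert S` = number of extreme points of `conv(emb '' S)`.  For a chart
`σ : ℝ` the *chart set* `U_σ(S) ⊆ S` consists of the points of `S` that are the UNIQUE maximisers over `S` of some
height `p ↦ t · p 0 + σ · p 1` (`t : ℝ`).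

Claim.  GIVEN the chart lemma `hchart` (the neighbouring stub Q1a, taken as a hypothesis: for every non-degenerate
chart `σ ≠ 0` and nonempty `A, B`, `|U_σ(A ⊕ B)| + 1 ≤ |U_σ(A)| + |U_σ(B)|`),
`#vert (P ⊕ Q) ≤ 2 · (#vert P + #vert Q)`.

Proof.
* `MinkowskiVertexBoundAux.extremePoints_subset_charts`: every vertex of `conv(emb '' S)` is `emb e₀` with
  `e₀ ∈ U_1(S) ∪ U_{-1}(S)`.  Indeed `NewtonUnitEquationsDissociatedUniform.stub_exposedGenericDirection S T` with
  `T = {0, single 1 1}` writes the vertex as `emb e₀`, `e₀ ∈ S` strictly exposed by a direction `w` whose height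
  is injective on `T`, whence `w 1 ≠ 0`; rescaling by `|w 1|⁻¹ > 0` (`chart_rescale`) puts the height in the
  chart `σ = sign (w 1) = ±1` with slope `t = w 0 / |w 1|`.  Counting through the embedding,
  `#vert S ≤ |U_1(S)| + |U_{-1}(S)|` (`ncard_le_of_subset_image_union`).
* `MinkowskiVertexBoundAux.ncard_chart_le`: conversely `U_σ(A) ↪ vert conv(emb '' A)`: a point of `U_σ(A)` is
  strictly exposed by the height in direction `(t, σ)`, hence a vertex
  (`RefineDissociateAux.emb_mem_extremePoints_of_strict`), and `emb` is injective (`ChartPairCount.emb_injective`).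
* `stub_minkowskiVertexBoundOfChart`: if `P` or `Q` is empty the sum and its hull are empty; otherwise combine
  the two bullets with `hchart` at `σ = 1` and `σ = -1` (only these two charts are used).

Everything is folklore planar convex geometry; no named facts, no citations, no `def`s.
-/

-- Sub = Summit single-conjunct layout: the duplicated namespace component is mandated by the tree.
set_option linter.dupNamespace false

noncomputable section

open scoped BigOperators
open Summit.ValiantsHypothesis.ValiantsHypothesis.Theorems.NewtonUnitEquationsDissociatedUniform
  (stub_exposedGenericDirection)

namespace Summit.ValiantsHypothesis.ValiantsHypothesis.Theorems.NewtonUnitEquationsNewtonTauWeak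

namespace MinkowskiVertexBoundAux

/-- Rescaling a strict height inequality `a x₀ + b x₁ < a y₀ + b y₁` by `c > 0` with `c * b = σ` puts it in
the chart `σ`: `(c a) x₀ + σ x₁ < (c a) y₀ + σ y₁`. [folklore] -/
theorem chart_rescale {a b c σ x₀ x₁ y₀ y₁ : ℝ} (hc : 0 < c) (hσ : c * b = σ)
    (h : a * x₀ + b * x₁ < a * y₀ + b * y₁) :
    c * a * x₀ + σ * x₁ < c * a * y₀ + σ * y₁ := by
  subst hσ
  calc c * a * x₀ + c * b * x₁ = c * (a * x₀ + b * x₁) := by ring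
    _ < c * (a * y₀ + b * y₁) := mul_lt_mul_of_pos_left h hc
    _ = c * a * y₀ + c * b * y₁ := by ring

/-- **Vertices lie in the two affine charts.**  Every extreme point of `conv(emb '' S)` is `emb e₀` for an
`e₀ ∈ S` which is the strict maximiser over `S` of a chart height `q ↦ t * q 0 + σ * q 1` with `σ = 1` or
`σ = -1`: the strictly exposing direction `w` of `stub_exposedGenericDirection`, chosen with injective
height on `{0, single 1 1}` (whence `w 1 ≠ 0`), is rescaled by `|w 1|⁻¹ > 0`. [folklore] -/
theorem extremePoints_subset_charts (S : Finset (Fin 2 →₀ ℕ)) :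
    Set.extremePoints ℝ (convexHull ℝ
        ((fun e : Fin 2 →₀ ℕ => fun i : Fin 2 => ((e i : ℕ) : ℝ)) '' (S : Set (Fin 2 →₀ ℕ)))) ⊆
      (fun e : Fin 2 →₀ ℕ => fun i : Fin 2 => ((e i : ℕ) : ℝ)) ''
        ({p : Fin 2 →₀ ℕ | p ∈ S ∧ ∃ t : ℝ, ∀ q ∈ S, q ≠ p →
            t * ((q 0 : ℕ) : ℝ) + 1 * ((q 1 : ℕ) : ℝ) < t * ((p 0 : ℕ) : ℝ) + 1 * ((p 1 : ℕ) : ℝ)} ∪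
          {p : Fin 2 →₀ ℕ | p ∈ S ∧ ∃ t : ℝ, ∀ q ∈ S, q ≠ p →
            t * ((q 0 : ℕ) : ℝ) + (-1) * ((q 1 : ℕ) : ℝ) <
              t * ((p 0 : ℕ) : ℝ) + (-1) * ((p 1 : ℕ) : ℝ)}) := by
  intro e he
  obtain ⟨w, e₀, he₀, rfl, hstrict, hinj⟩ :=
    stub_exposedGenericDirection S ({0, Finsupp.single 1 1} : Finset (Fin 2 →₀ ℕ)) e he
  -- genericity of the height on `{0, single 1 1}` forces `w 1 ≠ 0`
  have hw1 : w 1 ≠ 0 := by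
    intro hw
    have hT0 : (0 : Fin 2 →₀ ℕ) ∈
        (({0, Finsupp.single 1 1} : Finset (Fin 2 →₀ ℕ)) : Set (Fin 2 →₀ ℕ)) := by
      simp
    have hT1 : (Finsupp.single 1 1 : Fin 2 →₀ ℕ) ∈
        (({0, Finsupp.single 1 1} : Finset (Fin 2 →₀ ℕ)) : Set (Fin 2 →₀ ℕ)) := by
      simp
    have heq : (0 : Fin 2 →₀ ℕ) = Finsupp.single 1 1 :=
      hinj hT0 hT1 (by simp [Fin.sum_univ_two, hw])
    have h1 := DFunLike.congr_fun heq 1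
    simp at h1
  -- the strict exposure, coordinatewise
  have hstrict' : ∀ q ∈ S, q ≠ e₀ →
      w 0 * ((q 0 : ℕ) : ℝ) + w 1 * ((q 1 : ℕ) : ℝ) <
        w 0 * ((e₀ 0 : ℕ) : ℝ) + w 1 * ((e₀ 1 : ℕ) : ℝ) := by
    intro q hq hqe
    simpa only [Fin.sum_univ_two] using hstrict q hq hqe
  refine ⟨e₀, ?_, rfl⟩
  rcases hw1.lt_or_gt with hneg | hpos
  · -- `w 1 < 0`: chart `σ = -1`, rescale by `(-w 1)⁻¹`
    have hc : 0 < (-w 1)⁻¹ := inv_pos.2 (neg_pos.2 hneg)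
    have hσ : (-w 1)⁻¹ * w 1 = -1 := by
      rw [inv_mul_eq_div, div_neg, div_self hw1]
    exact Or.inr ⟨he₀, (-w 1)⁻¹ * w 0, fun q hq hqe => chart_rescale hc hσ (hstrict' q hq hqe)⟩
  · -- `0 < w 1`: chart `σ = 1`, rescale by `(w 1)⁻¹`
    have hc : 0 < (w 1)⁻¹ := inv_pos.2 hpos
    have hσ : (w 1)⁻¹ * w 1 = 1 := inv_mul_cancel₀ hw1
    exact Or.inl ⟨he₀, (w 1)⁻¹ * w 0, fun q hq hqe => chart_rescale hc hσ (hstrict' q hq hqe)⟩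

/-- Counting through a cover: if `E ⊆ f '' (U ∪ V)` with `U, V` finite then `#E ≤ #U + #V`. [folklore] -/
theorem ncard_le_of_subset_image_union {α β : Type*} (f : α → β) {E : Set β} {U V : Set α}
    (hU : U.Finite) (hV : V.Finite) (h : E ⊆ f '' (U ∪ V)) : E.ncard ≤ U.ncard + V.ncard :=
  calc E.ncard ≤ (f '' (U ∪ V)).ncard := Set.ncard_le_ncard h ((hU.union hV).image f)
    _ ≤ (U ∪ V).ncard := Set.ncard_image_le (hU.union hV)
    _ ≤ U.ncard + V.ncard := Set.ncard_union_le U V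

/-- The chart set `U_σ(A) ⊆ A` is finite. [folklore] -/
theorem finite_chart (A : Finset (Fin 2 →₀ ℕ)) (σ : ℝ) :
    {p : Fin 2 →₀ ℕ | p ∈ A ∧ ∃ t : ℝ, ∀ q ∈ A, q ≠ p →
        t * ((q 0 : ℕ) : ℝ) + σ * ((q 1 : ℕ) : ℝ) < t * ((p 0 : ℕ) : ℝ) + σ * ((p 1 : ℕ) : ℝ)}.Finite :=
  A.finite_toSet.subset fun _ hp => hp.1

/-- **Chart points are vertices.**  A point of `A` that is the strict maximiser over `A` of a chart height
`q ↦ t * q 0 + σ * q 1` embeds to an extreme point of `conv(emb '' A)`: it is strictly exposed by the height in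
direction `(t, σ)` (`RefineDissociateAux.emb_mem_extremePoints_of_strict`). [folklore] -/
theorem emb_mem_extremePoints_of_chart (A : Finset (Fin 2 →₀ ℕ)) (σ t : ℝ) {p : Fin 2 →₀ ℕ}
    (hp : p ∈ A)
    (h : ∀ q ∈ A, q ≠ p →
      t * ((q 0 : ℕ) : ℝ) + σ * ((q 1 : ℕ) : ℝ) < t * ((p 0 : ℕ) : ℝ) + σ * ((p 1 : ℕ) : ℝ)) :
    (fun i : Fin 2 => ((p i : ℕ) : ℝ)) ∈ Set.extremePoints ℝ (convexHull ℝ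
      ((fun e : Fin 2 →₀ ℕ => fun i : Fin 2 => ((e i : ℕ) : ℝ)) '' (A : Set (Fin 2 →₀ ℕ)))) := by
  refine RefineDissociateAux.emb_mem_extremePoints_of_strict A hp ![t, σ] fun q hq hqp => ?_
  simpa [Fin.sum_univ_two] using h q hq hqp

/-- **Chart count ≤ vertex count.**  `|U_σ(A)| ≤ #vert conv(emb '' A)`: `emb` maps `U_σ(A)` injectively into
the (finite) set of extreme points (`ChartPairCount.emb_injective`). [folklore] -/
theorem ncard_chart_le (A : Finset (Fin 2 →₀ ℕ)) (σ : ℝ) :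
    {p : Fin 2 →₀ ℕ | p ∈ A ∧ ∃ t : ℝ, ∀ q ∈ A, q ≠ p →
        t * ((q 0 : ℕ) : ℝ) + σ * ((q 1 : ℕ) : ℝ) < t * ((p 0 : ℕ) : ℝ) + σ * ((p 1 : ℕ) : ℝ)}.ncard ≤
      (Set.extremePoints ℝ (convexHull ℝ
        ((fun e : Fin 2 →₀ ℕ => fun i : Fin 2 => ((e i : ℕ) : ℝ)) '' (A : Set (Fin 2 →₀ ℕ))))).ncard := by
  refine Set.ncard_le_ncard_of_injOn (fun e : Fin 2 →₀ ℕ => fun i : Fin 2 => ((e i : ℕ) : ℝ))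
    (fun p hp => ?_) ChartPairCount.emb_injective.injOn
    ((A.finite_toSet.image _).subset extremePoints_convexHull_subset)
  obtain ⟨hpA, t, ht⟩ := hp
  exact emb_mem_extremePoints_of_chart A σ t hpA ht

end MinkowskiVertexBoundAux

open MinkowskiVertexBoundAux in
/-- **Stub `stub_minkowskiVertexBoundOfChart` (RungC7 Q1b, registered signature): hull vertices of a planar
Minkowski sum, given the chart lemma.**  For finite `P Q ⊆ ℕ²`, the convex hull of (the real embedding of)
`P ⊕ Q = (P ×ˢ Q).image (·.1 + ·.2)` has at most `2 · (#vert P + #vert Q)` extreme points, provided the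
chart inequality `|U_σ(A ⊕ B)| + 1 ≤ |U_σ(A)| + |U_σ(B)|` holds for all charts `σ ≠ 0` and nonempty `A, B`.
Proof: `#vert (P ⊕ Q) ≤ |U_1(P ⊕ Q)| + |U_{-1}(P ⊕ Q)|` (`extremePoints_subset_charts`),
`|U_σ(A)| ≤ #vert A` (`ncard_chart_le`), and `hchart` at `σ = 1, -1`; empty `P` or `Q` give an empty
hull. [folklore] -/
theorem stub_minkowskiVertexBoundOfChart
    (hchart : ∀ (σ : ℝ), σ ≠ 0 → ∀ (A B : Finset (Fin 2 →₀ ℕ)), A.Nonempty → B.Nonempty →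
      {p : Fin 2 →₀ ℕ | p ∈ (A ×ˢ B).image (fun pq : (Fin 2 →₀ ℕ) × (Fin 2 →₀ ℕ) => pq.1 + pq.2) ∧
          ∃ t : ℝ, ∀ q ∈ (A ×ˢ B).image (fun pq : (Fin 2 →₀ ℕ) × (Fin 2 →₀ ℕ) => pq.1 + pq.2), q ≠ p →
            t * ((q 0 : ℕ) : ℝ) + σ * ((q 1 : ℕ) : ℝ) < t * ((p 0 : ℕ) : ℝ) + σ * ((p 1 : ℕ) : ℝ)}.ncard + 1 ≤
        {p : Fin 2 →₀ ℕ | p ∈ A ∧ ∃ t : ℝ, ∀ q ∈ A, q ≠ p →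
            t * ((q 0 : ℕ) : ℝ) + σ * ((q 1 : ℕ) : ℝ) < t * ((p 0 : ℕ) : ℝ) + σ * ((p 1 : ℕ) : ℝ)}.ncard +
        {p : Fin 2 →₀ ℕ | p ∈ B ∧ ∃ t : ℝ, ∀ q ∈ B, q ≠ p →
            t * ((q 0 : ℕ) : ℝ) + σ * ((q 1 : ℕ) : ℝ) < t * ((p 0 : ℕ) : ℝ) + σ * ((p 1 : ℕ) : ℝ)}.ncard)
    (P Q : Finset (Fin 2 →₀ ℕ)) :
    (Set.extremePoints ℝ (convexHull ℝ ((fun e : Fin 2 →₀ ℕ => fun i : Fin 2 => ((e i : ℕ) : ℝ)) ''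
      (((P ×ˢ Q).image (fun pq : (Fin 2 →₀ ℕ) × (Fin 2 →₀ ℕ) => pq.1 + pq.2) : Finset (Fin 2 →₀ ℕ)) :
        Set (Fin 2 →₀ ℕ))))).ncard ≤
      2 * ((Set.extremePoints ℝ (convexHull ℝ ((fun e : Fin 2 →₀ ℕ => fun i : Fin 2 => ((e i : ℕ) : ℝ)) ''
          (P : Set (Fin 2 →₀ ℕ))))).ncard +
        (Set.extremePoints ℝ (convexHull ℝ ((fun e : Fin 2 →₀ ℕ => fun i : Fin 2 => ((e i : ℕ) : ℝ)) ''
          (Q : Set (Fin 2 →₀ ℕ))))).ncard) := by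
  rcases P.eq_empty_or_nonempty with rfl | hP
  · simp
  rcases Q.eq_empty_or_nonempty with rfl | hQ
  · simp
  -- `#vert (P ⊕ Q) ≤ |U_1(P ⊕ Q)| + |U_{-1}(P ⊕ Q)|`
  have hD := ncard_le_of_subset_image_union (fun e : Fin 2 →₀ ℕ => fun i : Fin 2 => ((e i : ℕ) : ℝ))
    (finite_chart _ 1) (finite_chart _ (-1))
    (extremePoints_subset_charts
      ((P ×ˢ Q).image (fun pq : (Fin 2 →₀ ℕ) × (Fin 2 →₀ ℕ) => pq.1 + pq.2)))
  -- the chart lemma at the two non-degenerate charts `σ = 1, -1`, and `|U_σ(A)| ≤ #vert A`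
  have h1 := hchart 1 one_ne_zero P Q hP hQ
  have h2 := hchart (-1) (neg_ne_zero.2 one_ne_zero) P Q hP hQ
  have hP1 := ncard_chart_le P 1
  have hQ1 := ncard_chart_le Q 1
  have hP2 := ncard_chart_le P (-1)
  have hQ2 := ncard_chart_le Q (-1)
  omega

end Summit.ValiantsHypothesis.ValiantsHypothesis.Theorems.NewtonUnitEquationsNewtonTauWeak

end
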